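import Summits.QuantumFields.YangMills.Theorems.ColdStartUniversalityShenZhuZhuW1DiracContractionSU2
import Summits.QuantumFields.YangMills.Theorems.ColdStartUniversalityLatticeLangevinSZZUniqueInvariant
import HarnessLib

/-!
# The `W₁` SHADOW of the named fact `shenZhuZhu_finiteVolumeErgodicity (fundamentalLatticeRep 2) 3` IS A THEOREM: Shen–Zhu–Zhu's Theorem 4.2 for `SU(2)`,
# `d = 3`, with the PRINTED hypotheses (`K_𝒮 = szzBakryEmeryConstSU 2 3 β > 0`, `L > 1`), the printed rate `e^(−K_𝒮 t)` and the printed uniqueness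
# clause — the one change being the transport cost `ρ_L` (`W₁`) in place of `ρ_L²` (`W₂`)

Seat `ym-line-csu-p1` (g41), route `ColdStartUniversality` of `Summits/QuantumFields/YangMills`, helper file G60 (`--supports stmt-QuantumFields-24809`).
The Literature renders SZZ Theorem 4.2 as
`shenZhuZhu_finiteVolumeErgodicity r d : 2 ≤ d → (r.IsDefiningSU → ∀ β, 0 < K_𝒮 → ∀ L > 1, SZZDiracContraction r d L (Nβ) K_𝒮 (torusRiemannDistSq r) ∧
SZZUniqueInvariantMeasure r d L (Nβ)) ∧ (r.IsDefiningSO → …)`.  This file proves, for `r = fundamentalLatticeRep 2`, `d = 3`, the statement obtained by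
replacing the squared cost `torusRiemannDistSq r` (so that `szzWassersteinSq` is `W₂²`) by its square root `ρ_L` (so that it is `W₁`) and the rate
parameter `K_𝒮` by `K_𝒮/2` in the `e^(−2Kt)` convention of `SZZDiracContraction` (so that the bound reads `W₁ ≤ e^(−K_𝒮 t)·ρ_L(Q,Q̄)`, exactly the
printed decay `e^(−K_𝒮 t) ρ_L` of (4.5)):

* ★★★★ `shenZhuZhu_finiteVolumeErgodicity_W1_su2`.

Ingredients: G58 (`wilson_szzWasserstein_W1_contraction`, rate `1 − 12|β'| ≥ K_𝒮 = 1 − 16|β'|` at `β' = 2β`), the tree's kernel realisation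
`exists_transitionKernel` and uniqueness `szzUniqueInvariantMeasure_su2`; the `SO` conjunct is vacuous (`szzBakryEmeryConstSO 2 3 β = −32|β| ≤ 0`).
THEOREMS ONLY, no definition, no sorry.  HONEST FRAMING: the named fact itself (`W₂`) is NOT discharged — `W₁ ≤ W₂`, so this is strictly weaker than
the printed (4.5); fixed cut-off; nothing `K`-uniform along the route's scaling; `UniformColdStartMixing` (24809, ASIDE) not restated; no crux, rung or
summit statement is proved; the Yang–Mills mass gap is NOT proved.
-/

set_option autoImplicit false

noncomputable section

namespace Summit.QuantumFields.YangMills.Theorems.ColdStartUniversality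

open MeasureTheory ProbabilityTheory Matrix Complex Finset Filter Topology Set
open scoped BigOperators NNReal ENNReal
open Literature.MathematicalPhysics.QuantumFieldTheory
open Literature.MathematicalPhysics.QuantumLattice (fundamentalRep fundamentalLatticeRep continuous_fundamentalRep fundamentalRep_apply fundamentalLatticeRep_N)

/-- ★★ **`W₁` Dirac contraction at the printed rate**: for `0 < K_𝒮 = szzBakryEmeryConstSU 2 3 β` (`= 1 − 32|β|`) and every `L`,
`SZZDiracContraction (fundamentalLatticeRep 2) 3 L (2β) (K_𝒮/2) ρ_L`, i.e. `W₁^{ρ_L}(law U_t, law U'_t) ≤ e^(−K_𝒮 t)·ρ_L(Q,Q̄)` for any two strong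
solutions from `Q`, `Q̄` (G58 at `β' = 2β`, `|β'| < 1/16`, and `1 − 12|β'| ≥ K_𝒮`). [cite: ShenZhuZhu2022, Theorem 4.2 (4.5)] -/
theorem szzDiracContraction_W1_su2_printedRate (L : ℕ) [NeZero L] (β : ℝ) (hK : 0 < szzBakryEmeryConstSU 2 3 β) :
    SZZDiracContraction (fundamentalLatticeRep 2) 3 L (2 * β) (szzBakryEmeryConstSU 2 3 β / 2)
      (fun U U' : GaugeConfig 3 L (Matrix.specialUnitaryGroup (Fin 2) ℂ) => Real.sqrt (torusRiemannDistSq (fundamentalLatticeRep 2) U U')) := by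
  have hKdef : szzBakryEmeryConstSU 2 3 β = 1 - 32 * |β| := by
    unfold szzBakryEmeryConstSU; norm_num; ring
  have hβ' : |2 * β| < 1 / 12 := by
    rw [abs_mul, abs_two]; rw [hKdef] at hK; linarith
  intro Ω _ P _ W hW U Q hU0 hU Ω' _ P' _ W' hW' U' Q' hU'0 hU' t
  obtain ⟨κ, hκ, -, hreal⟩ := exists_transitionKernel L (2 * β)
  haveI := hκ
  rw [← hreal t Q Ω P W hW U hU0 hU, ← hreal t Q' Ω' P' W' hW' U' hU'0 hU']
  refine (wilson_szzWasserstein_W1_contraction L Q Q' t (2 * β) hβ' κ hreal).trans (ENNReal.ofReal_le_ofReal ?_)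
  refine mul_le_mul_of_nonneg_right (Real.exp_le_exp.2 ?_) (Real.sqrt_nonneg _)
  -- `−(1 − 12|2β|)t ≤ −2(K_𝒮/2)t` since `K_𝒮 = 1 − 32|β| ≤ 1 − 24|β|`
  rw [hKdef, abs_mul, abs_two]
  have ht : 0 ≤ (t : ℝ) := t.2
  nlinarith [abs_nonneg β]

/-- ★★★★ **The `W₁` shadow of `shenZhuZhu_finiteVolumeErgodicity (fundamentalLatticeRep 2) 3`.**  With the PRINTED hypotheses of SZZ Theorem 4.2 for
`SU(2)`, `d = 3` (`K_𝒮 = szzBakryEmeryConstSU N 3 β > 0`, `N = (fundamentalLatticeRep 2).N = 2`, every `L > 1`), both printed conclusions hold with the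
transport cost `ρ_L` in place of `ρ_L²`: the Dirac contraction `W₁^{ρ_L}(δ_Q P_t^L, δ_Q̄ P_t^L) ≤ e^(−K_𝒮 t) ρ_L(Q,Q̄)` (shape `SZZDiracContraction` with rate
parameter `K_𝒮/2`) and the uniqueness of the invariant measure (`SZZUniqueInvariantMeasure`); the `SO` conjunct is vacuous.  The printed `W₂` statement
is stronger and is NOT proved here. [cite: ShenZhuZhu2022, Theorem 4.2 (4.5)] -/
theorem shenZhuZhu_finiteVolumeErgodicity_W1_su2 :
    2 ≤ (3 : ℕ) →
      ((fundamentalLatticeRep 2).IsDefiningSU → ∀ β : ℝ, 0 < szzBakryEmeryConstSU (fundamentalLatticeRep 2).N 3 β → ∀ (L : ℕ) [NeZero L], 1 < L →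
        SZZDiracContraction (fundamentalLatticeRep 2) 3 L ((fundamentalLatticeRep 2).N * β) (szzBakryEmeryConstSU (fundamentalLatticeRep 2).N 3 β / 2)
            (fun U U' : GaugeConfig 3 L (Matrix.specialUnitaryGroup (Fin 2) ℂ) => Real.sqrt (torusRiemannDistSq (fundamentalLatticeRep 2) U U')) ∧
          SZZUniqueInvariantMeasure (fundamentalLatticeRep 2) 3 L ((fundamentalLatticeRep 2).N * β)) ∧
      ((fundamentalLatticeRep 2).IsDefiningSO → ∀ β : ℝ, 0 < szzBakryEmeryConstSO (fundamentalLatticeRep 2).N 3 β → ∀ (L : ℕ) [NeZero L], 1 < L →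
        SZZDiracContraction (fundamentalLatticeRep 2) 3 L ((fundamentalLatticeRep 2).N * β) (szzBakryEmeryConstSO (fundamentalLatticeRep 2).N 3 β / 2)
            (fun U U' : GaugeConfig 3 L (Matrix.specialUnitaryGroup (Fin 2) ℂ) => Real.sqrt (torusRiemannDistSq (fundamentalLatticeRep 2) U U')) ∧
          SZZUniqueInvariantMeasure (fundamentalLatticeRep 2) 3 L ((fundamentalLatticeRep 2).N * β)) := by
  intro _
  refine ⟨fun _ β hK L _ _ => ?_, fun _ β hK => ?_⟩
  · have hN : (fundamentalLatticeRep 2).N = 2 := fundamentalLatticeRep_N 2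
    have hK2 : 0 < szzBakryEmeryConstSU 2 3 β := by rwa [hN] at hK
    have hcast : ((fundamentalLatticeRep 2).N : ℝ) * β = 2 * β := by rw [hN]; norm_num
    rw [hcast, hN]
    exact ⟨szzDiracContraction_W1_su2_printedRate L β hK2, szzUniqueInvariantMeasure_su2 L (2 * β)⟩
  · exfalso
    have hN : (fundamentalLatticeRep 2).N = 2 := fundamentalLatticeRep_N 2
    rw [hN] at hK
    unfold szzBakryEmeryConstSO at hK
    norm_num at hK
    nlinarith [abs_nonneg β]

end Summit.QuantumFields.YangMills.Theorems.ColdStartUniversality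

end
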